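import Summits.QuantumFields.BalabanUV.Beta.FP.TowerDoorRecordDefs
import Summits.QuantumFields.BalabanUV.Beta.FP.TowerDoorGaugeFunctional
import Summits.QuantumFields.BalabanUV.Beta.FP.TowerDoorDefectPairing

/-!
# `BalabanUV.Beta.FP.TowerDoorRecordPairing` — road «FP», binder row D1: **THE PAIRING DATA OF THE RECORD** (v10's letters `lamd τd Sd Rf kf` at an2 PART 69's instance; DEFINITIONS)
# (an2 J-NOTE-21 §3 ∕ §7 (C), Q-an2-77-1 (a) `Vd j := ↥(lp (fun _ : Site 4 => ℝ) ⊤)`; road XREAD-1 l.68778 (the same objects, elaborated NOT-TO-FILE) and OFFER-2 l.68798.)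

WHAT ([our object] bookkeeping definitions over PART 69's `lamRec ∕ SRec ∕ tabsRec ∕ omegaRec`, PART 61's `l1Pairing`, lit `PolarizationSign.axisReflect`; plus the two record facts the
definitions need; no `def … : Prop`, nothing cited, 0 sorry, default heartbeats).
§1 **`exists_rates_record`** — the record's localisation letters ALIGNED ONCE at door index `n+1`: one rate `δ > 0` with (Lmix) `LocStencilFM (Lc^(n+2)) (tabsRec n).mixFF C δ`
(`(tabsRec n).hmix` + lit `LocStencilFM.mono`), `Decays (AN (Roots.ctr Lc) (n+1)) CA (δ/2)` (`decays_AN` + `decays_of_le`) and (LH) `VertexFamily (tabsRec n).H (Lc^(n+2)) C_H δ`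
(`(tabsRec n).hH` at any rate) — the hypothesis shape of an2 PART 65∕67; **`summable_abs_omegaRec`** — the door functional's weight is `ℓ¹` (PART 67 `summable_abs_tadpole_defKerZ_single`).
§2 THE DATA, each `0` below the first storey (PART 69 `doorRec 0 = 0`): **`lamdRec`** (`⟨lamRec Lc (sn n) n μ y, memℓp_top_lamZ_record …⟩ : ↥(lp … ⊤)`), **`tauRec`**
(`κτ n • l1Pairing (omegaRec Lc Pn (κ₂ n) n κ (· − Lc^(n+2)•y)) _ : ↥(lp … ⊤) →ₗ[ℝ] ℝ`), **`SdRec`** (`SRec Lc (cS n) n`), the PART 46 socket letters **`NbRec j := Lc^(j+1)`**, **`cRec`**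
(`0 ∕ cS n`), the coordinate mirrors **`reflEquiv ρ`** (lit `axisReflect ρ` as an `Equiv`, involutive by lit `axisReflect_axisReflect`), **`RfRec j ν ρ := reflEquiv ρ`**, **`kfRec := 0`**.
§3 Unfoldings (`rfl`-class): `lamdRec_succ_apply`, `tauRec_zero_apply`, `tauRec_succ_apply`, `tauRec_succ_lamdRec` (`τd (n+1) κ y (lamd (n+1) μ z) = κτ n·Σ'_u ω n κ (u − L•y)·lamRec μ z u`),
`SdRec_zero ∕ _succ`, `SdRec_eq_cRec_mul_wΦ` (PART 46's displayed `hS` shape at every `j`), `RfRec_apply`, `kfRec_apply`.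
WHAT THIS IS NOT: not the letters `hX hτd hτda hΘ hWΔ₂ hSd hSda hdiv hRA hRc` themselves (the companion `…RecordLetters`), not (T2); nothing of Bałaban's asserted, valued or
discharged; 0 estimates; 0∕4 row-D1 binders (hW, hR, D1Tel, D1Rep); v10 NOT filed; NOT (C1), NOT (T-ID), NOT D1, NEVER «G-an2-4 closed», NOT BetaPertH, NOT continuum, NOT Clay.
HONEST DEPENDENCY (page 1, mandatory): continuum YM on T⁴ ⇐ BetaPertH ∧ nine spine estimates (0/9 proved); BetaPertH ⇐ (D1) ∧ (D4) ∧ CAP+tail;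
G-an2-4 gates asym, D1 and NE2/3/4.  HONEST FRAMING (cell contract, verbatim): «discharging `BetaPertH` makes Bałaban's UV stability UNCONDITIONAL —
a real constructive-QFT result; it is NOT the continuum limit and NOT the Clay problem.»  ABSOLUTE RULE (cell charter, verbatim): «No internally-minted
statement may enter as a cited fact. Every hypothesis is either kernel-proved in this package or a verbatim quotation of a PUBLISHED theorem with page
reference. The manuscript(s) under audit are NOT citable for their own disputed steps — they are the thing under adjudication; programme-internal
(2001/route/tribunal) claims are never citable.»  Road «FP» OWNER, b2b-balaban-beta-d1-p3 gen 55, 2026-08-29.  No existing file touched.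
-/

noncomputable section

open scoped BigOperators ENNReal

namespace Summit.QuantumFields.BalabanUV.Beta.FP.TowerDoorRecordPairing

open Literature.MathematicalPhysics.QuantumFieldTheory
open Literature.MathematicalPhysics.QuantumFieldTheory.Balaban1983to89
open Literature.MathematicalPhysics.QuantumFieldTheory.Balaban1983to89.Beta
open AffineAveraging (Site unitVec)
open AveragingContoursRooted (ctrOff ctrOff_mem_box)
open OneStepResolventKernel (Fib)
open ExpKernelCalculus (MKer Decays VertexFamily tadpole)
open SecondOrderResponse (LocStencilFM)
open KernelSpecInstance (wΦ)
open PolarizationSign (axisReflect axisReflect_axisReflect)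
open Summit.QuantumFields.BalabanUV.Beta.CompositeOneShotJetData (Roots Pins AN)
open Summit.QuantumFields.BalabanUV.Beta.NVertexSectors (decays_AN)
open Summit.QuantumFields.BalabanUV.Beta.DecayingKernelNeumann (decays_of_le)
open Summit.QuantumFields.BalabanUV.Beta.GAN24.FineReadoutCauchyFrame (toSite_mem_range)
open Summit.QuantumFields.BalabanUV.Beta.FP.TowerDoorDefectDefs (defKerZ)
open Summit.QuantumFields.BalabanUV.Beta.FP.TowerDoorRecordDefs
open Summit.QuantumFields.BalabanUV.Beta.FP.TowerDoorGaugeFunctional (l1Pairing l1Pairing_apply memℓp_top_lamZ_record)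
open Summit.QuantumFields.BalabanUV.Beta.FP.TowerDoorDefectPairing (summable_abs_tadpole_defKerZ_single)

variable (Lc : ℕ) [NeZero Lc] (Pn : Pins)

/-! ## §1 The record's rates aligned once; the door functional's weight is `ℓ¹` -/

/-- [folklore] **`exists_rates_record`** — at door index `n+1`, ONE rate `δ > 0` such that (Lmix) holds at `δ`, the record chart `AN (Roots.ctr Lc) (n+1)` decays at `δ/2` and (LH) holds at `δ`
(the hypothesis shape of an2 PART 65 `tadpole_doorZ` ∕ PART 67 `tadpole_defKerZ_eq_tsum_single`): `(tabsRec n).hmix` + lit `LocStencilFM.mono`, `decays_AN` + `decays_of_le`, `(tabsRec n).hH`. -/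
theorem exists_rates_record (n : ℕ) : ∃ δ C CA C_H : ℝ, 0 < δ ∧ 0 ≤ CA ∧
    LocStencilFM (Lc ^ (n + 1 + 1)) (tabsRec Lc Pn n).mixFF C δ ∧ Decays (AN (Roots.ctr Lc) (n + 1)) CA (δ / 2) ∧
    VertexFamily (tabsRec Lc Pn n).H (Lc ^ (n + 1 + 1)) C_H δ := by
  obtain ⟨C, δm, hδm, hmix⟩ := (tabsRec Lc Pn n).hmix
  obtain ⟨δA, CA, hδA, hCA, hA⟩ := decays_AN (Roots.ctr Lc) (n + 1)
  set δ : ℝ := min δm (2 * δA) with hδ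
  have hδ0 : 0 < δ := lt_min hδm (by linarith)
  obtain ⟨C_H, hH⟩ := (tabsRec Lc Pn n).hH δ hδ0.le
  refine ⟨δ, C, CA, C_H, hδ0, hCA, hmix.mono (min_le_left _ _), decays_of_le hA ?_, hH⟩
  have h2 : δ ≤ 2 * δA := min_le_right _ _
  linarith

/-- [folklore] **`summable_abs_omegaRec` — THE DOOR FUNCTIONAL's WEIGHT IS `ℓ¹`** (an2 PART 67 `summable_abs_tadpole_defKerZ_single` at the record's aligned rates, window `(0, κ)`). -/
theorem summable_abs_omegaRec (κ₂ : ℝ) (n : ℕ) (κ : Fin (3 + 1)) :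
    Summable fun u : Site (3 + 1) => |omegaRec Lc Pn κ₂ n κ u| := by
  obtain ⟨δ, C, CA, C_H, hδ, _, hmix, hA, hH⟩ := exists_rates_record Lc Pn n
  exact summable_abs_tadpole_defKerZ_single (Lc ^ (n + 1 + 1)) (tabsRec Lc Pn n) κ₂ hδ hA hmix hH ((0 : Site (3 + 1)), κ)

/-! ## §2 The pairing data of the record -/

section Defs

variable (sn cS κ₂ κτ : ℕ → ℝ)

/-- [our object — bookkeeping] **`lamd` OF v10 AT THE RECORD**: zero below the first storey; at door index `n+1` PART 69's `lamRec Lc (sn n) n μ y` packaged as an element of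
`Vd := ↥(lp (fun _ : Site (3+1) => ℝ) ⊤)` by PART 61 `memℓp_top_lamZ_record` (Q-an2-77-1 (a)). -/
def lamdRec : ∀ _j : ℕ, Fin (3 + 1) → Site (3 + 1) → ↥(lp (fun _ : Site (3 + 1) => ℝ) ⊤)
  | 0 => fun _ _ => 0
  | n + 1 => fun μ y => ⟨lamRec Lc (sn n) n μ y,
      memℓp_top_lamZ_record (fun i : ℕ => n + 1 - i) n (Roots.ctr Lc) (fun _ : ℕ => ctrOff (3 + 1) Lc)
        (fun _ => toSite_mem_range (ctrOff_mem_box (d := 3 + 1) (Nat.one_le_iff_ne_zero.mpr (NeZero.ne Lc))))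
        (Sum.elim (fun _ : Fin (3 + 1) => (1 : ℝ)) (fun _ : Fin (3 + 1) => (sn n)⁻¹)) μ y⟩

/-- [our object — bookkeeping] **`τd` OF v10 AT THE RECORD — THE DOOR FUNCTIONAL**: zero below the first storey; at door index `n+1` and window `(y, κ)` the `ℓ¹`–`ℓ^∞` pairing against the
translated weight, `κτ n • l1Pairing (u ↦ omegaRec Lc Pn (κ₂ n) n κ (u − Lc^(n+2)•y))` (PART 61 `l1Pairing`; the `ℓ¹` proof is §1 transported by `Equiv.subRight`). -/
def tauRec : ∀ _j : ℕ, Fin (3 + 1) → Site (3 + 1) → (↥(lp (fun _ : Site (3 + 1) => ℝ) ⊤) →ₗ[ℝ] ℝ)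
  | 0 => fun _ _ => 0
  | n + 1 => fun κ y => κτ n • l1Pairing (fun u : Site (3 + 1) => omegaRec Lc Pn (κ₂ n) n κ (u - (((Lc ^ (n + 1 + 1) : ℕ) : ℤ) • y)))
      ((Equiv.subRight ((((Lc ^ (n + 1 + 1) : ℕ) : ℤ)) • y)).summable_iff.mpr (summable_abs_omegaRec Lc Pn (κ₂ n) n κ))

/-- [our object — bookkeeping] **`Sd` OF v10 AT THE RECORD — THE READ-OUT WEIGHT**: zero below the first storey; PART 69's `SRec Lc (cS n) n` at door index `n+1`. -/
def SdRec : ℕ → Fin (3 + 1) → Site (3 + 1) → Fin (3 + 1) → Site (3 + 1) → ℝ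
  | 0 => fun _ _ _ _ => 0
  | n + 1 => SRec Lc (cS n) n

/-- [our object — bookkeeping] the block letter of an2 PART 46's read-out socket at door index `j`: `Lc^(j+1)` (reducible, so that `NeZero` is found). -/
abbrev NbRec (j : ℕ) : ℕ := Lc ^ (j + 1)

/-- [our object — bookkeeping] the scalar letter of an2 PART 46's read-out socket: `0` below the first storey, `cS n` at door index `n+1`. -/
def cRec : ℕ → ℝ
  | 0 => 0
  | n + 1 => cS n

/-- [our object — bookkeeping] **the coordinate mirror `ε_ρ` as an equivalence** (lit `PolarizationSign.axisReflect ρ`, an involution by lit `axisReflect_axisReflect`). -/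
def reflEquiv (ρ : Fin (3 + 1)) : Site (3 + 1) ≃ Site (3 + 1) :=
  ⟨axisReflect ρ, axisReflect ρ, axisReflect_axisReflect ρ, axisReflect_axisReflect ρ⟩

/-- [our object — bookkeeping] **`Rf` OF v10 AT THE RECORD**: the mirror in the coordinate `ρ`, at every door index and source direction (an2 PART 46's displayed `hRf` shape). -/
def RfRec : ℕ → Fin (3 + 1) → Fin (3 + 1) → Site (3 + 1) ≃ Site (3 + 1) := fun _ _ ρ => reflEquiv ρ

/-- [our object — bookkeeping] **`kf` OF v10 AT THE RECORD**: the mirror offsets vanish (the source sits at the origin). -/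
def kfRec : ℕ → Fin (3 + 1) → Fin (3 + 1) → ℝ := fun _ _ _ => 0

end Defs

/-! ## §3 Unfoldings -/

section Unfold

variable (sn cS κ₂ κτ : ℕ → ℝ)

/-- [folklore] `lamd 0 = 0` (`rfl`). -/
theorem lamdRec_zero (μ : Fin (3 + 1)) (y : Site (3 + 1)) : lamdRec Lc sn 0 μ y = 0 := rfl

/-- [folklore] the bounded function under `lamd (n+1) μ y` is PART 69's `lamRec Lc (sn n) n μ y` (`rfl`). -/
theorem lamdRec_succ_apply (n : ℕ) (μ : Fin (3 + 1)) (y u : Site (3 + 1)) :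
    (lamdRec Lc sn (n + 1) μ y : Site (3 + 1) → ℝ) u = lamRec Lc (sn n) n μ y u := rfl

/-- [folklore] `τd 0 = 0` (`rfl`). -/
theorem tauRec_zero (κ : Fin (3 + 1)) (y : Site (3 + 1)) : tauRec Lc Pn κ₂ κτ 0 κ y = 0 := rfl

/-- [folklore] **the door functional unfolded**: `τd (n+1) κ y v = κτ n · Σ'_u omegaRec Lc Pn (κ₂ n) n κ (u − Lc^(n+2)•y) · v u`. -/
theorem tauRec_succ_apply (n : ℕ) (κ : Fin (3 + 1)) (y : Site (3 + 1)) (v : ↥(lp (fun _ : Site (3 + 1) => ℝ) ⊤)) :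
    tauRec Lc Pn κ₂ κτ (n + 1) κ y v
      = κτ n * ∑' u : Site (3 + 1), omegaRec Lc Pn (κ₂ n) n κ (u - (((Lc ^ (n + 1 + 1) : ℕ) : ℤ) • y)) * (v : Site (3 + 1) → ℝ) u := by
  simp only [tauRec, LinearMap.smul_apply, l1Pairing_apply, smul_eq_mul]

/-- [folklore] **the door functional on the record gauge function**: `τd (n+1) κ y (lamd (n+1) μ z) = κτ n · Σ'_u omegaRec … κ (u − Lc^(n+2)•y) · lamRec Lc (sn n) n μ z u`. -/
theorem tauRec_succ_lamdRec (n : ℕ) (κ : Fin (3 + 1)) (y : Site (3 + 1)) (μ : Fin (3 + 1)) (z : Site (3 + 1)) :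
    tauRec Lc Pn κ₂ κτ (n + 1) κ y (lamdRec Lc sn (n + 1) μ z)
      = κτ n * ∑' u : Site (3 + 1), omegaRec Lc Pn (κ₂ n) n κ (u - (((Lc ^ (n + 1 + 1) : ℕ) : ℤ) • y)) * lamRec Lc (sn n) n μ z u := by
  rw [tauRec_succ_apply]; rfl

/-- [folklore] `Sd 0 = 0` (`rfl`). -/
theorem SdRec_zero (ν : Fin (3 + 1)) (z : Site (3 + 1)) (κ : Fin (3 + 1)) (y : Site (3 + 1)) : SdRec Lc cS 0 ν z κ y = 0 := rfl

/-- [folklore] `Sd (n+1) = SRec Lc (cS n) n` (`rfl`). -/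
theorem SdRec_succ (n : ℕ) : SdRec Lc cS (n + 1) = SRec Lc (cS n) n := rfl

/-- [folklore] **`SdRec` IN an2 PART 46's DISPLAYED SOCKET SHAPE** at every door index: `Sd j ν z κ y = cRec j · wΦ (N := Lc^(j+1)) κ ν (y − z)`. -/
theorem SdRec_eq_cRec_mul_wΦ (j : ℕ) (ν : Fin (3 + 1)) (z : Site (3 + 1)) (κ : Fin (3 + 1)) (y : Site (3 + 1)) :
    SdRec Lc cS j ν z κ y = cRec cS j * wΦ (N := NbRec Lc j) κ ν (y - z) := by
  cases j with
  | zero => simp [SdRec, cRec]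
  | succ n => rfl

/-- [folklore] the record's mirrors are the coordinate reflections (`rfl`). -/
theorem RfRec_apply (j : ℕ) (ν ρ : Fin (3 + 1)) (w : Site (3 + 1)) : RfRec j ν ρ w = axisReflect ρ w := rfl

/-- [folklore] the record's mirror offsets vanish (`rfl`). -/
theorem kfRec_apply (j : ℕ) (ν ρ : Fin (3 + 1)) : kfRec j ν ρ = 0 := rfl

end Unfold

end Summit.QuantumFields.BalabanUV.Beta.FP.TowerDoorRecordPairing

end
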